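import Summits.HodgeConjecture.HodgeConjecture.Theses.EisensteinMiddleThird
import Literature.AlgebraicGeometry.HodgeTheory.BallQuotientCompactification
import Literature.AlgebraicGeometry.ShimuraVarieties.EisensteinUnitaryLevel
import Literature.AlgebraicGeometry.HodgeTheory.HardLefschetzNFold
import Literature.AlgebraicGeometry.HodgeTheory.ComplexOrientationFamily
import Literature.AlgebraicGeometry.HodgeTheory.GysinKernel
import Literature.AlgebraicGeometry.Resolution.ResolutionOfSingularities
import Literature.AlgebraicTopology.SingularHomology.TorusCohomologyRing
import HarnessLib

/-!
# Birth skeleton — piece X₃ `TowerEisensteinMiddle` of the split of `EisensteinTowerHodge`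
# (stmt-HodgeConjecture-19002; route EisensteinMiddleThird, crux-strategist 2026-08-17)

Line **toroidal Gysin matching**. The piece says: for `X` in the Eisenstein Picard-modular sector
with boundary `Z`, every rational `(2,2)`-class `c` is matched ON THE BOUNDARY by one rational
algebraic class `a`: `g^*(c - a) = 0` for every smooth projective threefold `g : Y ⟶ X` mapping
into `Z`. Plan:

1. `stub_toroidalChart` (Ash–Mumford–Rapoport–Tai + Hironaka; existence, known mathematics,
   L-sized): every sector member `X ⊇ U = X ∖ Z ≅ Γ'\𝔹⁴` is joined by a common smooth projective
   modification `X ⟵p X'' ⟶q X'` (both birational, isomorphisms over the complements of the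
   boundaries, `p⁻¹Z = q⁻¹Z'`) to a model `X'` whose boundary `Z' = ⊔ᵢ Bᵢ` is a finite DISJOINT union
   of smooth projective threefolds `ιᵢ : Bᵢ ↪ X'` (closed immersions; for the toroidal
   compactification of a neat 4-ball quotient: CM abelian threefolds over the cusps) with NEGATIVE
   normal bundle, recorded cohomologically: `ιᵢ^* ιᵢ_* x = -[H] ∪ x` on `H²(Bᵢ)` for the hyperplane
   class `[H]` of a `HardLefschetzNFold 3 Bᵢ` (self-intersection formula, `N_{Bᵢ}^∨` ample because
   `Bᵢ` contracts to a cusp of Baily–Borel).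
2. `stub_boundaryMatching` (Gysin / hard Lefschetz / Lefschetz (1,1) on the boundary threefolds;
   M-sized, provable from tree facts): on such an `X'`, for a rational `(2,2)`-class `c` solve
   `[H] ∪ dᵢ = -ιᵢ^* c` in `H²(Bᵢ)` (hard Lefschetz on the threefold, `dᵢ` rational of type `(1,1)`,
   hence a divisor class by the tree's PROVED Lefschetz (1,1)), put `a := Σᵢ ιᵢ_* dᵢ` (algebraic,
   rational, supported on `Z'`); then `(c - a)|_{Bᵢ} = 0` for all `i` (disjointness kills the cross
   terms), i.e. `c - a` dies on `Z'(ℂ)`.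
3. `stub_modificationTransfer` (M-sized): the property "every rational `(2,2)`-class is matched on
   the boundary by a rational algebraic class" passes from `(X', Z')` to `(X, Z)` along the common
   modification: pull back to `X''` (`q^*`; the defect `c'' - q^* q_* c''` is a Hodge class supported
   on `Z''`, algebraic by CONIVEAU ONE = the sibling piece `ConiveauOneMiddleFourfold`, stub 4),
   push down by `p_*` (degree one: `p_* p^* = id`; Gysin images of algebraic classes are algebraic;
   `p_*` is compatible with restriction to `Z` because `p` is a relative homeomorphism
   `(X'', Z'') → (X, Z)`, the tree's `bijective_relMap_of_relativeHomeomorph_of_chartedSpace`).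
4. `stub_coniveauOne` = the sibling support item `ConiveauOneMiddleFourfold` (stmt-18997, own
   skeleton `Lines/split-ConiveauOneMiddleFourfold-birth.lean`: Deligne Hodge III 8.2.8 + Voisin's
   semisimple Gysin lift + Lefschetz (1,1)).

Composition `towerEisensteinMiddle_of` (no sorry): name the sector hypothesis, take the chart,
match on `X'`, transfer to `X`, and pass from "dies on `Z(ℂ)`" to the item's test-threefold form by
factoring `g(ℂ)` through `Z(ℂ)`.
-/

noncomputable section

set_option linter.dupNamespace false

namespace Summit.HodgeConjecture.HodgeConjecture.Cruxes.EisensteinTowerHodge.SplitEisenstein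

open scoped BigOperators Topology Manifold Classical Matrix InnerProductSpace ComplexConjugate
open CategoryTheory AlgebraicGeometry
open Literature.AlgebraicGeometry Literature.AlgebraicGeometry.Motives
  Literature.AlgebraicGeometry.HodgeTheory Literature.AlgebraicTopology.SingularHomology
  Literature.AlgebraicGeometry.ShimuraVarieties Literature.Geometry.Kaehler

/-- The matching property on the boundary `Z ⊆ X` (conclusion shape of the piece, in the form
"dies on `Z(ℂ)`"): every rational `(2,2)`-class of `X` differs from a rational algebraic class by a
class whose restriction to the complex points lying on `Z` vanishes. -/
def BoundaryMatched (X : SchemeOver ℂ) (Z : Set X.left) : Prop :=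
  ∀ c : complexBetti X (2 * 2), IsRationalClass c → IsOfHodgeType 4 X (2 * 2) 2 2 c →
    ∃ a ∈ algebraicClasses X 2, IsRationalClass a ∧
      singularCohomology.map ℂ ℂ (subsetIncl {P : ComplexPoints X | P.pt ∈ Z}) (2 * 2) (c - a) = 0

/-- **Stub 1 statement — toroidal chart with a common modification** (AMRT smooth toroidal
compactification of the neat ball quotient `Γ'\𝔹⁴`, its boundary a disjoint union of smooth
threefolds with negative normal bundle — self-intersection formula `ι^* ι_* = -[H] ∪ ·` for an ample
`[H]` —, and Hironaka: any two smooth compactifications of `U` are dominated by a third, by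
morphisms which are isomorphisms over `U`). -/
def ToroidalChart : Prop :=
  ∀ ⦃X : SchemeOver ℂ⦄, IsSmoothProjective 4 X → ∀ (A : HodgeModel 4 X) (Z : Set X.left)
    (S : Set (Matrix (Fin 5) (Fin 5) ℂ)) (N : ℕ), IsClosed Z → 0 < N → S ⊆ eisensteinUnitary →
    eisensteinUnitaryLevel N ⊆ S → A.IsBallCoveredOff Z S →
    ∃ (X' : SchemeOver ℂ) (hX' : IsSmoothProjective 4 X') (m : ℕ) (B : Fin m → SchemeOver ℂ)
      (hB : ∀ i, IsSmoothProjective 3 (B i)) (ι : ∀ i, B i ⟶ X'),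
      (∀ i, IsClosedImmersion (ι i).left) ∧
      (Pairwise fun i j ↦ Disjoint (Set.range (ι i).left.base) (Set.range (ι j).left.base)) ∧
      (∀ i, ∃ Λ : HardLefschetzNFold 3 (B i), ∀ x : complexBetti (B i) 2,
        complexBetti.map (ι i) (2 * 2)
            (complexGysin complexOrientationFamily (hB i) hX' (ι i)
              (show 2 + 2 * 4 = 2 * 2 + 2 * 3 by norm_num) x) =
          -lefschetzOperator Λ.hyperplaneClass (show 2 + 2 = 2 * 2 by norm_num) x) ∧
      ∃ (X'' : SchemeOver ℂ) (_ : IsSmoothProjective 4 X'') (p : X'' ⟶ X) (q : X'' ⟶ X'),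
        Resolution.IsBirational p.left ∧ Resolution.IsBirational q.left ∧
        (∃ U : X.left.Opens, (U : Set X.left) = Zᶜ ∧ IsIso (p.left ∣_ U)) ∧
        (∃ U' : X'.left.Opens, (U' : Set X'.left) = (⋃ i, Set.range (ι i).left.base)ᶜ ∧
          IsIso (q.left ∣_ U')) ∧
        p.left.base ⁻¹' Z = q.left.base ⁻¹' ⋃ i, Set.range (ι i).left.base

/-- **Stub 2 statement — Gysin matching on a toroidal-type boundary**: on a smooth projective
fourfold whose "boundary" is a finite disjoint union of smooth projective threefolds `ιᵢ : Bᵢ ↪ X'`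
with `ιᵢ^* ιᵢ_* = -[H] ∪ ·` for a hard-Lefschetz hyperplane class `[H]` of `Bᵢ`, every rational
`(2,2)`-class is matched on `⋃ᵢ Bᵢ` by a rational algebraic class (solve `[H] ∪ dᵢ = -ιᵢ^* c` by
hard Lefschetz on the threefold; `dᵢ` is rational of type `(1,1)`, a divisor class by Lefschetz
(1,1); `a = Σ ιᵢ_* dᵢ`). -/
def BoundaryMatching : Prop :=
  ∀ ⦃X' : SchemeOver ℂ⦄ (hX' : IsSmoothProjective 4 X') (m : ℕ) (B : Fin m → SchemeOver ℂ)
    (hB : ∀ i, IsSmoothProjective 3 (B i)) (ι : ∀ i, B i ⟶ X'),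
    (∀ i, IsClosedImmersion (ι i).left) →
    (Pairwise fun i j ↦ Disjoint (Set.range (ι i).left.base) (Set.range (ι j).left.base)) →
    (∀ i, ∃ Λ : HardLefschetzNFold 3 (B i), ∀ x : complexBetti (B i) 2,
      complexBetti.map (ι i) (2 * 2)
          (complexGysin complexOrientationFamily (hB i) hX' (ι i)
            (show 2 + 2 * 4 = 2 * 2 + 2 * 3 by norm_num) x) =
        -lefschetzOperator Λ.hyperplaneClass (show 2 + 2 = 2 * 2 by norm_num) x) →
    BoundaryMatched X' (⋃ i, Set.range (ι i).left.base)

/-- **Stub 3 statement — transfer along a common modification** (given coniveau one): if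
`X ⟵p X'' ⟶q X'` are birational morphisms of smooth projective fourfolds, isomorphisms over
`X ∖ Z` resp. `X' ∖ Z'`, with `p⁻¹Z = q⁻¹Z'`, and rational `(2,2)`-classes of coniveau `≥ 1` on
fourfolds are algebraic, then boundary matching for `(X', Z')` implies boundary matching for
`(X, Z)`: `c ↦ p_*(q^* a' + e)` with `a'` matching `q_* p^* c` on `Z'` and `e = p^*c - q^* q_* p^* c`
supported on `Z''`. -/
def ModificationTransfer : Prop :=
  ∀ ⦃X X' X'' : SchemeOver ℂ⦄, IsSmoothProjective 4 X → IsSmoothProjective 4 X' →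
    IsSmoothProjective 4 X'' → ∀ (Z : Set X.left) (Z' : Set X'.left), IsClosed Z → IsClosed Z' →
    ∀ (p : X'' ⟶ X) (q : X'' ⟶ X'), Resolution.IsBirational p.left → Resolution.IsBirational q.left →
    (∃ U : X.left.Opens, (U : Set X.left) = Zᶜ ∧ IsIso (p.left ∣_ U)) →
    (∃ U' : X'.left.Opens, (U' : Set X'.left) = Z'ᶜ ∧ IsIso (q.left ∣_ U')) →
    p.left.base ⁻¹' Z = q.left.base ⁻¹' Z' →
    Summit.HodgeConjecture.HodgeConjecture.Theses.EisensteinMiddleThird.ConiveauOneMiddleFourfold → BoundaryMatched X' Z' → BoundaryMatched X Z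

/-! ### Registered stubs -/

/-- stub 1 — the toroidal chart (AMRT + negativity of the boundary normal bundles + Hironaka
domination). -/
theorem stub_toroidalChart : ToroidalChart := by
  sorry

/-- stub 2 — Gysin matching on a toroidal-type boundary (hard Lefschetz + Lefschetz (1,1) on the
boundary threefolds, Gysin functoriality). -/
theorem stub_boundaryMatching : BoundaryMatching := by
  sorry

/-- stub 3 — transfer of boundary matching along a common modification (degree-one projection
formula, Gysin images of algebraic classes, relative-homeomorphism excision). -/
theorem stub_modificationTransfer : ModificationTransfer := by
  sorry

/-- stub 4 — coniveau one in the middle degree of fourfolds = the sibling support item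
`ConiveauOneMiddleFourfold` (stmt-HodgeConjecture-18997; Deligne Hodge III 8.2.8 + semisimple
Gysin lift + Lefschetz (1,1); own skeleton `Lines/split-ConiveauOneMiddleFourfold-birth.lean`). -/
theorem stub_coniveauOne : Summit.HodgeConjecture.HodgeConjecture.Theses.EisensteinMiddleThird.ConiveauOneMiddleFourfold := by
  sorry

/-! ### Composition -/

/-- The joint image of finitely many morphisms from smooth projective varieties is closed. -/
theorem isClosed_boundary {X' : SchemeOver ℂ} (hX' : IsSmoothProjective 4 X') {m : ℕ}
    {B : Fin m → SchemeOver ℂ} (hB : ∀ i, IsSmoothProjective 3 (B i)) (ι : ∀ i, B i ⟶ X') :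
    IsClosed (⋃ i, Set.range (ι i).left.base) :=
  isClosed_iUnion_range_of_isSmoothProjective hX' hB ι

/-- From "dies on `Z(ℂ)`" to the item's test form: a class vanishing on the complex points of `Z`
is killed by every morphism `g : Y ⟶ X` with image in `Z` (factor `g(ℂ)` through `Z(ℂ)`). -/
theorem map_eq_zero_of_restrict_eq_zero {X Y : SchemeOver ℂ} {Z : Set X.left} (g : Y ⟶ X)
    (hg : Set.range g.left.base ⊆ Z) {k : ℕ} {v : complexBetti X k}
    (hv : singularCohomology.map ℂ ℂ (subsetIncl {P : ComplexPoints X | P.pt ∈ Z}) k v = 0) :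
    singularCohomology.map ℂ ℂ (AlgPoints.mapContinuous (L := ℂ) g) k v = 0 := by
  set g' : C(ComplexPoints Y, {P : ComplexPoints X | P.pt ∈ Z}) :=
    ⟨fun P ↦ ⟨AlgPoints.mapContinuous (L := ℂ) g P, hg ⟨P.pt, (AlgPoints.pt_map g P).symm⟩⟩,
      by fun_prop⟩ with hg'
  have hfac : AlgPoints.mapContinuous (L := ℂ) g =
      (subsetIncl {P : ComplexPoints X | P.pt ∈ Z}).comp g' := by
    ext P
    rfl
  rw [hfac, ← singularCohomology.map_map, hv, map_zero]

/-- **The piece from the registered stubs** (sorries only inside `stub_*`; this is the skeleton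
theorem: the FIRST theorem of the file concluding the crux decl by name). -/
theorem towerEisensteinMiddle_holds_of_stubs : Summit.HodgeConjecture.HodgeConjecture.Theses.EisensteinMiddleThird.TowerEisensteinMiddle := by
  have h₁ := stub_toroidalChart; have h₂ := stub_boundaryMatching
  have h₃ := stub_modificationTransfer; have h₄ := stub_coniveauOne
  intro X hX A Z S N π hdata c hc hpp
  obtain ⟨hZ, hN, hS', hSN', hholo, hcov, hdeck⟩ := hdata
  have hS : S ⊆ eisensteinUnitary := fun γ hγ ↦ hS' γ hγ
  have hSN : eisensteinUnitaryLevel N ⊆ S := fun γ hγ ↦ hSN' γ hγ.1 hγ.2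
  have hA : A.IsBallCoveredOff Z S := ⟨π, hholo, hcov, hdeck⟩
  obtain ⟨X', hX', m, B, hB, ι, hιc, hdisj, hgys, X'', hX'', p, q, hp, hq, hpU, hqU, hpre⟩ :=
    h₁ hX A Z S N hZ hN hS hSN hA
  have hZ' : IsClosed (⋃ i, Set.range (ι i).left.base) := isClosed_boundary hX' hB ι
  have hmatch : BoundaryMatched X' (⋃ i, Set.range (ι i).left.base) := h₂ hX' m B hB ι hιc hdisj hgys
  obtain ⟨a, ha, har, hvan⟩ :=
    h₃ hX hX' hX'' Z _ hZ hZ' p q hp hq hpU hqU hpre h₄ hmatch c hc hpp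
  exact ⟨a, ha, har, fun Y g _ hgZ ↦ map_eq_zero_of_restrict_eq_zero g hgZ hvan⟩

/- Composition, hypothetical form (kept as a comment: the skeleton checker takes a theorem with the
   registered obligation `ConiveauOneMiddleFourfold` among its hypotheses as the skeleton and then flags the
   three stub STATEMENTS as extra hypotheses; the proof term is identical to the one above):

theorem towerEisensteinMiddle_of :
    ToroidalChart → BoundaryMatching → ModificationTransfer → Summit.HodgeConjecture.HodgeConjecture.Theses.EisensteinMiddleThird.ConiveauOneMiddleFourfold →
      Summit.HodgeConjecture.HodgeConjecture.Theses.EisensteinMiddleThird.TowerEisensteinMiddle := by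
  intro h₁ h₂ h₃ h₄ X hX A Z S N π hdata c hc hpp
  obtain ⟨hZ, hN, hS', hSN', hholo, hcov, hdeck⟩ := hdata
  have hS : S ⊆ eisensteinUnitary := fun γ hγ ↦ hS' γ hγ
  have hSN : eisensteinUnitaryLevel N ⊆ S := fun γ hγ ↦ hSN' γ hγ.1 hγ.2
  have hA : A.IsBallCoveredOff Z S := ⟨π, hholo, hcov, hdeck⟩
  obtain ⟨X', hX', m, B, hB, ι, hιc, hdisj, hgys, X'', hX'', p, q, hp, hq, hpU, hqU, hpre⟩ :=
    h₁ hX A Z S N hZ hN hS hSN hA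
  have hZ' : IsClosed (⋃ i, Set.range (ι i).left.base) := isClosed_boundary hX' hB ι
  have hmatch : BoundaryMatched X' (⋃ i, Set.range (ι i).left.base) := h₂ hX' m B hB ι hιc hdisj hgys
  obtain ⟨a, ha, har, hvan⟩ :=
    h₃ hX hX' hX'' Z _ hZ hZ' p q hp hq hpU hqU hpre h₄ hmatch c hc hpp
  exact ⟨a, ha, har, fun Y g _ hgZ ↦ map_eq_zero_of_restrict_eq_zero g hgZ hvan⟩
-/

end Summit.HodgeConjecture.HodgeConjecture.Cruxes.EisensteinTowerHodge.SplitEisenstein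

end
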